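import Mathlib
import Literature.Topology.Euclidean.BrouwerFixedPoint
import Literature.Geometry.Riemannian.SimpleManifoldBallStarShaped
import HarnessLib

/-!
# A local homeomorphism defined on a closed ball is injective (step towards PSU Prop. 3.8.5)

Support file for the discharge of `PaternainSaloUhlmann2023_simple_sublevel_ball`
(`SimpleManifoldBall.lean`; G. P. Paternain, M. Salo, G. Uhlmann, *Geometric Inverse Problems*,
CUP 2023, Prop. 3.8.5: for a simple manifold `exp_x : D_x → M` is a diffeomorphism). The printed
proof obtains INJECTIVITY of `exp_x` on `D_x` from Prop. 3.8.4 (uniqueness of geodesics between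
two points, via the Morse theory of Props. 3.7.22 and 3.7.24). The discharge in the tree replaces
this by the following purely topological fact, applied to `exp_x` on the star-shaped compact
domain `D_x ≃ₜ B̄` (`exists_homeomorph_radial_closedBall`) once it is known to be a local
homeomorphism onto the domain `D` (no conjugate points + transversality at the boundary):

* `injective_of_isLocalHomeomorph_closedBall`: **a local homeomorphism `p : B̄ → X` from the
  closed unit ball of a finite-dimensional real inner product space to a Hausdorff space is
  injective.** Proof: `B̄` is compact, so `p` is a covering map
  (`IsCoveringMapOn.of_isLocalHomeomorphOn`); `B̄` is simply connected and locally path-connected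
  (convex), so for `p a₁ = p a₂` the lifting criterion
  (`IsCoveringMap.existsUnique_continuousMap_lifts`) lifts `p` through `p` to a deck map
  `Φ : B̄ → B̄` with `Φ a₁ = a₂`; by **Brouwer's fixed point theorem** (the tree's
  `Literature.Topology.Euclidean.Brouwer.exists_fixedPoint_closedBall`) `Φ` fixes some `a`, and
  lifts through a covering map from a connected space agreeing at one point coincide, so
  `Φ = id` and `a₁ = a₂`.
* `injective_of_isLocalHomeomorph_of_homeomorph_closedBall`: the same for any space
  homeomorphic to `B̄`.

Everything is proved; no named facts. (The deck-transformation/Brouwer argument is folklore;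
compare the standard proof that a finite group acting freely on a disk is trivial.)
-/

noncomputable section

open Set Metric Function

namespace Literature.Geometry.Riemannian

variable {F : Type*} [NormedAddCommGroup F] [InnerProductSpace ℝ F] [FiniteDimensional ℝ F]
  {X : Type*} [TopologicalSpace X] [T2Space X]

/-- **A local homeomorphism from the closed unit ball to a Hausdorff space is injective**
(covering-space argument: compact domain ⇒ covering map; simply connected, locally
path-connected domain ⇒ `p` lifts through itself to a deck map moving `a₁` to `a₂`; Brouwer ⇒
the deck map has a fixed point ⇒ it is the identity). [folklore] -/
theorem injective_of_isLocalHomeomorph_closedBall {p : closedBall (0 : F) 1 → X}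
    (hp : IsLocalHomeomorph p) : Injective p := by
  classical
  haveI : CompactSpace (closedBall (0 : F) 1) :=
    isCompact_iff_compactSpace.1 (isCompact_closedBall (0 : F) 1)
  haveI : ContractibleSpace (closedBall (0 : F) 1) :=
    (convex_closedBall (0 : F) 1).contractibleSpace ⟨0, mem_closedBall_self zero_le_one⟩
  haveI : LocallyPathConnectedSpace (closedBall (0 : F) 1) :=
    (convex_closedBall (0 : F) 1).locallyPathConnectedSpace
  have hpc : Continuous p := hp.continuous
  have hcov : IsCoveringMap p :=
    isCoveringMap_iff_isCoveringMapOn_univ.2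
      (IsCoveringMapOn.of_isLocalHomeomorphOn hpc fun e _ ↦ hp e)
  set P : C(closedBall (0 : F) 1, X) := ⟨p, hpc⟩ with hP
  intro a₁ a₂ h
  -- lift `p` through `p`, sending `a₁` to `a₂`
  obtain ⟨Φ, ⟨hΦa, hΦp⟩, -⟩ := hcov.existsUnique_continuousMap_lifts P a₁ a₂ h.symm
  -- Brouwer: the deck map `Φ` has a fixed point
  obtain ⟨a, haΦ⟩ : ∃ a : closedBall (0 : F) 1, Φ a = a := by
    set f : F → F := fun v ↦ if hv : v ∈ closedBall (0 : F) 1 then (Φ ⟨v, hv⟩ : F) else v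
      with hf
    have hrestr : (closedBall (0 : F) 1).restrict f = Subtype.val ∘ Φ := by
      ext ⟨v, hv⟩
      simp only [restrict_apply, comp_apply, hf, dif_pos hv]
    have hfc : ContinuousOn f (closedBall (0 : F) 1) := by
      rw [continuousOn_iff_continuous_restrict, hrestr]
      exact continuous_subtype_val.comp Φ.continuous
    have hfm : MapsTo f (closedBall (0 : F) 1) (closedBall (0 : F) 1) := fun v hv ↦ by
      simp only [hf, dif_pos hv]
      exact (Φ ⟨v, hv⟩).2
    obtain ⟨v, hv, hfix⟩ :=
      Literature.Topology.Euclidean.Brouwer.exists_fixedPoint_closedBall hfc hfm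
    refine ⟨⟨v, hv⟩, Subtype.ext ?_⟩
    have h' := hfix
    simp only [hf, dif_pos hv] at h'
    exact h'
  -- lifts agreeing at the fixed point coincide: `Φ = id`
  obtain ⟨Ψ, -, huniq⟩ := hcov.existsUnique_continuousMap_lifts P a a rfl
  have h1 : Φ = Ψ := huniq Φ ⟨haΦ, hΦp⟩
  have h2 : ContinuousMap.id (closedBall (0 : F) 1) = Ψ :=
    huniq (ContinuousMap.id (closedBall (0 : F) 1)) ⟨rfl, rfl⟩
  have hΦid : Φ a₁ = a₁ := by
    rw [h1, ← h2]
    rfl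
  rw [← hΦid, hΦa]

/-- **A local homeomorphism from a space homeomorphic to the closed unit ball to a Hausdorff space
is injective** (transport of `injective_of_isLocalHomeomorph_closedBall`). In the discharge of
PSU Prop. 3.8.5 this is applied to `exp_x` on the compact star-shaped domain `D_x`, homeomorphic
to the closed ball by `exists_homeomorph_radial_closedBall`. [folklore] -/
theorem injective_of_isLocalHomeomorph_of_homeomorph_closedBall {K : Type*} [TopologicalSpace K]
    (e : K ≃ₜ closedBall (0 : F) 1) {p : K → X} (hp : IsLocalHomeomorph p) : Injective p := by
  have hq : IsLocalHomeomorph (p ∘ e.symm) := hp.comp e.symm.isLocalHomeomorph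
  have hinj := injective_of_isLocalHomeomorph_closedBall hq
  intro a₁ a₂ h
  have h' : (p ∘ e.symm) (e a₁) = (p ∘ e.symm) (e a₂) := by simpa using h
  exact e.injective (hinj h')

end Literature.Geometry.Riemannian

end
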